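import Summits.CriticalPhenomena.PercolationContinuityZ3.Theorems.PercNearOneGluingNoHeavyQuantBubbleData
import HarnessLib

/-!
# QUANT lane R8, T-DEC: THE BUBBLE FAMILY — a closed-form, k-GENERAL solution of the conditioned-compound problem ("PROBLEM(L_m, S′)"), and
# with the compound cut the k-general certificate 'identity I_k' (= arm-1 g46's identity I at k = 3) as a theorem of the list binder

builds on p205010 (kernel theorem, internal audit signed; external expert review pending)

Support + definition file (`--supports stmt-CriticalPhenomena-4575`), QUANT lane seat prim-quant-arm-1 (gen 47, architect), rung R8 of
`run/shared/lean/prim/quant/LADDER.md`; memo `run/shared/lean/prim/quant/prim-quant-arm-1-g47/ARCH-G47.md` §2–§4 (exact numerics: the decomposition is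
an identity for every m; coverage of identity I_k on generic k-2-chain forests 180/300 (k = 3, = identity I), 170/300 (k = 4), 194/300 (k = 5), 115/150
(k = 6); with the atomic theorem 259/240/254/133).  Theorems only (no definitions), standard axioms, no sorries.  Continues `…QuantCompoundCut`
(`fQ`, `fbeta`, `sdec_flaw_cons_of_upart`) and `…QuantBubbleData` (the gates `blam`/`bkap`, weights, floor `bfl` and region `BubbleOK` of the recursion,
`bubble_scalars`, `bubble_step_facts`, `bfl_pos`).

THE BUBBLE RECURSION (answer to lead V410 (2)/V411 (2): "PROBLEM(L₃, S′) by hub-splitting", for every width).  The opened compound of a list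
`b :: L′` (outer box `b` = revealed first; `L′ ≠ []` the inner compound, already decomposed as `fbeta L′ = Σ ω P` into hierarchies of conditioned mean
`T = bT L′`) splits by the root of `b`:  `fbeta (b :: L′) = p(1−Q′)·ρ_b + pQ′·Σ ω (P ∗ ρ_b) + (1−p)·Σ ω P`  (`p = q_b / fQ (b :: L′)`, `Q′ = fQ L′`), and the
two BLENDS  `X_P = P ∗ gate_λ ρ_b = λ(P ∗ ρ_b) + (1−λ)P`  (box `b` hung under the hub of `P`) and  `Y_P = gate_κ P ∗ ρ_b = κ(P ∗ ρ_b) + (1−κ)ρ_b`  (the piece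
`P` hung under the opened box `b`) with  `λ = p(R − (1−Q′)T)/R`,  `κ = ((1−p+pQ′)T − (1−p)R)/T`  (`R = mean ρ_b`) both have mean EXACTLY `T′ = bT (b :: L′)`;
with weights `u = (1−p)R/D`, `v = p(1−Q′)T/D`, `D = (1−p)R + p(1−Q′)T` (`u + v = 1`, `uλ + vκ = pQ′`, `u(1−λ) = 1−p`, `v(1−κ) = p(1−Q′)`) the mixture
`Σ ω (u·X_P + v·Y_P)` IS `fbeta (b :: L′)`.  Region: `λ > 0 ⟺ R > (1−Q′)T`, `κ > 0 ⟺ (1−p+pQ′)T > (1−p)R` (`BubbleOK`); every piece is tree-built with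
at most `fgates − 1` nontrivial gates (one opened hub) at a floor `≥ bfl` (X: `λ·x₁(b)`; Y: `κ ×` the inner floors).  `2^{m−1}` pieces for `m` boxes; for
`m = 2` the two pieces are identity I's `U₁`, `U₂` with the same gates.  With the compound cut: **the sibling step holds for `sk :: L` whenever
`sk.q < fQ L`, `BubbleOK L` and `x ≤ fQ L · bfl L`** — a k-general LARGE-outer-gate family (its coverage RISES with k), complementary to the atomic
theorem (small outer gates, `…QuantAtomicRegating`).

* **`fbeta_bubble`**: `TreeOK` list with `BubbleOK` ⟹ `fbeta L` is a finite mixture (positive weights, sum 1) of laws `P`, each TREE-BUILT at a floor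
  `≥ bfl L` with `≤ fgates L − 1` nontrivial gates, on `{0..ftop L}`, of mean exactly `bT L`.
* **`sdec_upart_of_bubble`**: with the oracle below `fgates (sk :: L)` and `sk.q < fQ L`: the conditioned compound with the carrier hung under it,
  `fbeta L ∗ gate_{sk.q/fQ L} sk.ρ`, is SDEC at `min (bfl L) ((sk.q/fQ L)·sk.x₁)`.
* **`sdec_flaw_cons_of_bubble`** (identity I_k): oracle, `sk.q < fQ L`, `BubbleOK L`, `x ≤ fQ L · bfl L` ⟹ `SDEC x (ftop (sk :: L)) (flaw (sk :: L))`.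

HONEST STATUS: an explicit sub-family (floors bind: all census failures are floor failures); `SiblingStep`, `GateStepN`, `FarTreeRow` OPEN; RATE class
log\* / honest sentence unchanged.  [this work]; identity I (k = 3): prim-quant-arm-1 g46; two-root identity: arm-1 g45; list binder: prim-quant-stmt g39.
Nothing here is cited as a published result.  The gluing rows served [cite: KozmaNitzan2024, Conjecture 3 (p. 15)]; product measure
[cite: Grimmett1999, §1.3 p. 10].
-/

noncomputable section

open scoped BigOperators

namespace Summit.CriticalPhenomena.PercolationContinuityZ3.Theorems
namespace Quant
namespace LawDec

open Finset

/-! ### The bubble decomposition of the opened compound -/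

/-- **THE BUBBLE DECOMPOSITION.**  For a list `L` of tree-built siblings at floor `x` in the bubble region (`BubbleOK L`, so `L ≠ []`): the opened
compound `fbeta L` is a finite mixture `Σ ωᵢ Pᵢ` (`ωᵢ > 0`, `Σ ωᵢ = 1`) of laws each TREE-BUILT at a floor `yᵢ ≥ bfl L` with `mᵢ + 1 ≤ fgates L`
nontrivial gates, on `{0..ftop L}`, and of mean EXACTLY the conditioned mean `bT L`.  (Pieces = the `2^{m−1}` nested hierarchies of the bubble
recursion; `m = 1`: the opened tree itself.) [this work] -/
theorem fbeta_bubble {x : ℝ} (hx0 : 0 < x) (hx1 : x < 1) :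
    ∀ (L : List Sib), (∀ s ∈ L, s.TreeOK x) → BubbleOK L →
      ∃ (ι : Type) (_ : Fintype ι) (ω : ι → ℝ) (m : ι → ℕ) (y : ι → ℝ) (P : ι → ℕ → ℝ),
        (∀ i, 0 < ω i) ∧ (∑ i, ω i = 1) ∧ (∀ h, fbeta L h = ∑ i, ω i * P i h) ∧
        (∀ i, TreeBuiltN (y i) (m i) (ftop L) (P i) ∧ bfl L ≤ y i ∧ m i + 1 ≤ fgates L ∧
          ∑ h ∈ Finset.range (ftop L + 1), (h : ℝ) * P i h = bT L)
  | [], _, hB => absurd hB (by simp [BubbleOK])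
  | [s], hL, _ => by
    obtain ⟨hq0, hq1, hxq, hT, _⟩ := hL s List.mem_cons_self
    obtain ⟨_, _, ρ0, ρM, ρ1, _⟩ := hT.lawFacts
    refine ⟨Unit, inferInstance, fun _ => 1, fun _ => s.n, fun _ => s.x₁, fun _ => s.ρ, fun _ => one_pos, by simp, fun h => ?_,
      fun _ => ⟨by simpa [ftop] using hT, by simp [bfl], by simp [fgates], ?_⟩⟩
    · simp only [Finset.univ_unique, Finset.sum_singleton, one_mul, fbeta, flaw, fQ, ftop]
      rw [lconv_delta_left 0 s.M _ (fun k hk => by rw [gate_apply, ρM k hk, if_neg (by omega)]; ring) h, gate_apply]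
      field_simp
      ring
    · simp only [ftop, Nat.zero_add, bT, fmean, fQ]
      unfold Sib.mean
      field_simp
      ring
  | b :: s :: L'', hL, hB => by
    -- data of the inner compound `L' = s :: L''`
    set L' : List Sib := s :: L'' with hL'def
    have hne : L' ≠ [] := by simp [hL'def]
    have hbT : b.TreeOK x := hL b List.mem_cons_self
    have hLT : ∀ t ∈ L', t.TreeOK x := fun t ht => hL t (List.mem_cons_of_mem b ht)
    have hLL : ∀ t ∈ L', t.LawOK := fun t ht => (hLT t ht).lawOK
    obtain ⟨hB', h1, h2⟩ := hB
    obtain ⟨ι, hι, ω, m, y, P, hω0, hω1, hmix, hP⟩ := fbeta_bubble hx0 hx1 L' hLT hB'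
    obtain ⟨hq0, hq1, hxq, hTb, hnp⟩ := hbT
    obtain ⟨hx₁0, hx₁1, ρ0, ρM, ρ1, ρta⟩ := hTb.lawFacts
    have hR : 0 < b.mean := (mul_pos_iff_of_pos_left (hL b List.mem_cons_self).1).1 (Sib.qmean_pos b (hL b List.mem_cons_self))
    have hT0 : 0 < bT L' := bT_pos L' hLT hne
    obtain ⟨hp0, hp1, hD0, hl0, hl1, hk0, hk1, hTc⟩ :=
      bubble_step_facts b L' (hL b List.mem_cons_self).lawOK hR hLL hne hT0 h1 h2
    have hD0' : (1 - bp b L') * b.mean + bp b L' * (1 - fQ L') * bT L' ≠ 0 := by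
      have := hD0; unfold bD at this; exact this.ne'
    obtain ⟨huv, hmid, hu1, hv1⟩ := bubble_scalars (bp b L') (fQ L') b.mean (bT L') hR.ne' hT0.ne' hD0'
    obtain ⟨f0, fM, f1, _⟩ := flaw_facts L' hLL
    obtain ⟨β0, βM, β1, βmean⟩ := fbeta_laws L' hLL hne
    obtain ⟨_, hQ1', hmem⟩ := fQ_facts L' hLL
    have hQ0' : 0 < fQ L' := lt_of_lt_of_le (hLT s List.mem_cons_self).1 (hmem s List.mem_cons_self)
    have hQc : fQ (b :: L') = fQ L' + b.q * (1 - fQ L') := rfl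
    have hQc0 : 0 < fQ (b :: L') := by rw [hQc]; nlinarith
    -- the weights and gates of the step (kept folded)
    set p : ℝ := bp b L' with hpdef
    set lam : ℝ := blam b L' with hlamdef
    set kap : ℝ := bkap b L' with hkapdef
    set u : ℝ := (1 - p) * b.mean / ((1 - p) * b.mean + p * (1 - fQ L') * bT L') with hudef
    set v : ℝ := p * (1 - fQ L') * bT L' / ((1 - p) * b.mean + p * (1 - fQ L') * bT L') with hvdef
    have hlamE : lam = p * (b.mean - (1 - fQ L') * bT L') / b.mean := by rw [hlamdef]; rfl
    have hkapE : kap = ((1 - p + p * fQ L') * bT L' - (1 - p) * b.mean) / bT L' := by rw [hkapdef]; rfl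
    have hDpos : 0 < (1 - p) * b.mean + p * (1 - fQ L') * bT L' := by
      have := hD0; unfold bD at this; rw [hpdef]; exact this
    have hu0 : 0 < u := div_pos (mul_pos (by linarith) hR) hDpos
    have hv0 : 0 < v := div_pos (mul_pos (mul_pos hp0 (by linarith)) hT0) hDpos
    have hp_q : p * fQ (b :: L') = b.q := by rw [hpdef]; unfold bp; field_simp
    have h1p : 1 - p = (1 - b.q) * fQ L' / fQ (b :: L') := by
      rw [hpdef]; unfold bp; field_simp; rw [hQc]; ring
    -- law facts of the pieces `P i`
    have Pfacts : ∀ i, (∀ k, 0 ≤ P i k) ∧ (∀ k, ftop L' < k → P i k = 0) ∧ (∑ k ∈ Finset.range (ftop L' + 1), P i k = 1) := by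
      intro i
      obtain ⟨hTP, _, _, _⟩ := hP i
      obtain ⟨_, _, P0, PM, P1, _⟩ := hTP.lawFacts
      exact ⟨P0, PM, P1⟩
    refine ⟨ι × Bool, inferInstance,
      fun ib => if ib.2 then ω ib.1 * u else ω ib.1 * v,
      fun ib => if ib.2 then m ib.1 + (b.n + 1) else (m ib.1 + 1) + b.n,
      fun ib => if ib.2 then min (y ib.1) (lam * b.x₁) else min (kap * y ib.1) b.x₁,
      fun ib => if ib.2 then lconv (ftop L') b.M (P ib.1) (gate b.ρ lam) else lconv (ftop L') b.M (gate (P ib.1) kap) b.ρ,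
      ?_, ?_, fun h => ?_, ?_⟩
    · -- positivity of the weights
      rintro ⟨i, c⟩
      cases c
      · simp only [Bool.false_eq_true, if_false]; exact mul_pos (hω0 i) hv0
      · simp only [if_true]; exact mul_pos (hω0 i) hu0
    · -- total weight
      rw [Fintype.sum_prod_type]
      simp only [Fintype.sum_bool, if_true, Bool.false_eq_true, if_false]
      have e : ∀ i, ω i * u + ω i * v = ω i * (u + v) := fun i => by ring
      simp_rw [e]
      rw [← Finset.sum_mul, hω1, one_mul, hudef, hvdef]
      exact huv
    · -- the mixture identity at `h`
      rw [Fintype.sum_prod_type]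
      simp only [Fintype.sum_bool, if_true, Bool.false_eq_true, if_false]
      -- expand the pieces
      have eX : ∀ i, lconv (ftop L') b.M (P i) (gate b.ρ lam) h = lam * lconv (ftop L') b.M (P i) b.ρ h + (1 - lam) * P i h :=
        fun i => lconv_gate_right _ _ _ _ _ (Pfacts i).2.1 h
      have eY : ∀ i, lconv (ftop L') b.M (gate (P i) kap) b.ρ h = kap * lconv (ftop L') b.M (P i) b.ρ h + (1 - kap) * b.ρ h :=
        fun i => lconv_gate_left _ _ _ _ _ ρM h
      simp_rw [eX, eY]
      -- the opened compound of `b :: L'` in terms of the inner pieces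
      set A : ℝ := ∑ i, ω i * lconv (ftop L') b.M (P i) b.ρ h with hAdef
      set B : ℝ := ∑ i, ω i * P i h with hBdef
      have emix : fbeta L' = fun k => ∑ i, ω i * P i k := funext hmix
      have hβconv : lconv (ftop L') b.M (fbeta L') b.ρ h = A := by
        rw [hAdef, emix]; exact lconv_fsum_left Finset.univ _ _ ω P b.ρ h
      have eflaw : flaw L' = fun k => fQ L' * fbeta L' k + (1 - fQ L') * (if k = 0 then (1 : ℝ) else 0) := by
        funext k; rw [flaw_eq_gate_fbeta L' hLL hne k, gate_apply]
      have hfl : flaw (b :: L') h = b.q * lconv (ftop L') b.M (flaw L') b.ρ h + (1 - b.q) * flaw L' h := by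
        show lconv (ftop L') b.M (flaw L') (gate b.ρ b.q) h = _
        exact lconv_gate_right _ _ _ _ _ fM h
      have hfl2 : lconv (ftop L') b.M (flaw L') b.ρ h = fQ L' * A + (1 - fQ L') * b.ρ h := by
        rw [eflaw, lconv_lin_left, lconv_delta_left _ _ _ ρM h, hβconv]
      have hfl3 : flaw L' h = fQ L' * B + (1 - fQ L') * (if h = 0 then (1 : ℝ) else 0) := by
        rw [flaw_eq_gate_fbeta L' hLL hne h, gate_apply, hmix h]
      have hstep : fbeta (b :: L') h = p * fQ L' * A + p * (1 - fQ L') * b.ρ h + (1 - p) * B := by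
        show (flaw (b :: L') h - (1 - fQ (b :: L')) * (if h = 0 then (1 : ℝ) else 0)) / fQ (b :: L') = _
        rw [div_eq_iff hQc0.ne', hfl, hfl2, hfl3, h1p]
        rw [show p = b.q / fQ (b :: L') from rfl]
        field_simp
        rw [hQc]
        ring
      rw [hstep]
      -- compare coefficients
      have eL : ∀ i, ω i * u * (lam * lconv (ftop L') b.M (P i) b.ρ h + (1 - lam) * P i h)
            + ω i * v * (kap * lconv (ftop L') b.M (P i) b.ρ h + (1 - kap) * b.ρ h)
          = (u * lam + v * kap) * (ω i * lconv (ftop L') b.M (P i) b.ρ h) + (u * (1 - lam)) * (ω i * P i h)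
            + (v * (1 - kap)) * (ω i * b.ρ h) := fun i => by ring
      simp_rw [eL]
      rw [Finset.sum_add_distrib, Finset.sum_add_distrib, ← Finset.mul_sum, ← Finset.mul_sum, ← Finset.mul_sum, ← Finset.sum_mul, hω1,
        one_mul, ← hAdef, ← hBdef]
      have e1 : u * lam + v * kap = p * fQ L' := by rw [hudef, hvdef, hlamE, hkapE]; exact hmid
      have e2 : u * (1 - lam) = 1 - p := by rw [hudef, hlamE]; exact hu1
      have e3 : v * (1 - kap) = p * (1 - fQ L') := by rw [hvdef, hkapE]; exact hv1
      rw [e1, e2, e3]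
      ring
    · -- the pieces: tree-built, floors, gate counts, means
      rintro ⟨i, c⟩
      obtain ⟨hTP, hyfl, hmg, hPmean⟩ := hP i
      obtain ⟨hy0, hy1, P0, PM, P1, _⟩ := hTP.lawFacts
      have htopc : ftop (b :: L') = ftop L' + b.M := rfl
      have hgc : fgates (b :: L') = fgates L' + (b.n + 1) := rfl
      have hbfl : bfl (b :: L') = min (min (bfl L') (lam * b.x₁)) (min b.x₁ (kap * bfl L')) := by
        rw [hL'def]; rfl
      have hmeanb : ∑ k ∈ Finset.range (b.M + 1), (k : ℝ) * b.ρ k = b.mean := rfl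
      cases c
      · -- Y-piece: `gate_κ P ∗ ρ_b`
        simp only [Bool.false_eq_true, if_false]
        have hfl0 : 0 < min (kap * y i) b.x₁ := lt_min (mul_pos hk0 hy0) hx₁0
        refine ⟨?_, ?_, by rw [hgc]; omega, ?_⟩
        · rw [htopc]
          exact TreeBuiltN.conv
            (TreeBuiltN.mono (TreeBuiltN.gate kap hk0 hk1 hTP) hfl0 (min_le_left _ _))
            (TreeBuiltN.mono hTb hfl0 (min_le_right _ _))
        · rw [hbfl]
          refine le_min ?_ ?_
          · exact (min_le_right _ _).trans ((min_le_right _ _).trans (mul_le_mul_of_nonneg_left hyfl hk0.le))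
          · exact (min_le_right _ _).trans (min_le_left _ _)
        · obtain ⟨g0, gM, g1⟩ := gate_laws (ftop L') (P i) kap hk0.le hk1.le P0 PM P1
          rw [htopc, sum_mul_lconv _ _ _ _ g1 ρ1, sum_mul_gate, hPmean, hmeanb, hTc, hkapE]
          field_simp
          ring
      · -- X-piece: `P ∗ gate_λ ρ_b`
        simp only [if_true]
        have hfl0 : 0 < min (y i) (lam * b.x₁) := lt_min hy0 (mul_pos hl0 hx₁0)
        refine ⟨?_, ?_, by rw [hgc]; omega, ?_⟩
        · rw [htopc]
          exact TreeBuiltN.conv (TreeBuiltN.mono hTP hfl0 (min_le_left _ _))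
            (TreeBuiltN.mono (TreeBuiltN.gate lam hl0 hl1 hTb) hfl0 (min_le_right _ _))
        · rw [hbfl]
          refine le_min ?_ ?_
          · exact (min_le_left _ _).trans ((min_le_left _ _).trans hyfl)
          · exact (min_le_left _ _).trans (min_le_right _ _)
        · obtain ⟨g0, gM, g1⟩ := gate_laws b.M b.ρ lam hl0.le hl1.le ρ0 ρM ρ1
          rw [htopc, sum_mul_lconv _ _ _ _ P1 g1, sum_mul_gate, hPmean, hmeanb, hTc, hlamE]
          field_simp
          ring

/-! ### The U-part and the k-general certificate -/

/-- **THE CONDITIONED COMPOUND WITH THE CARRIER IS SDEC (bubble region).**  Oracle below `fgates (sk :: L)`, `sk` and `L` tree-built at floor `x`,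
`sk.q < fQ L`, `BubbleOK L` ⟹ `fbeta L ∗ gate_{sk.q/fQ L} sk.ρ` is SDEC at `min (bfl L) ((sk.q / fQ L)·sk.x₁)` (each bubble piece with the carrier hung
under its hub is tree-built with fewer gates than the forest, hence SDEC by the oracle; all have the same mean; `decAtT_mixture_finset`). [this work] -/
theorem sdec_upart_of_bubble {x : ℝ} (hx0 : 0 < x) (hx1 : x < 1) (sk : Sib) (L : List Sib)
    (hk : sk.TreeOK x) (hL : ∀ s ∈ L, s.TreeOK x) (hB : BubbleOK L)
    (hO : ∀ (x' : ℝ) (n' M' : ℕ) (μ' : ℕ → ℝ), n' < fgates (sk :: L) → TreeBuiltN x' n' M' μ' → SDEC x' M' μ')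
    (hhub : sk.q < fQ L) :
    SDEC (min (bfl L) (sk.q / fQ L * sk.x₁)) (ftop L + sk.M) (lconv (ftop L) sk.M (fbeta L) (gate sk.ρ (sk.q / fQ L))) := by
  classical
  have hne : L ≠ [] := by rintro rfl; exact hB
  obtain ⟨ι, hι, ω, m, y, P, hω0, hω1, hmix, hP⟩ := fbeta_bubble hx0 hx1 L hL hB
  obtain ⟨hq0, hq1, hxq, hT, _⟩ := hk
  obtain ⟨hx₁0, hx₁1, ρ0, ρM, ρ1, _⟩ := hT.lawFacts
  have hL' : ∀ s ∈ L, s.LawOK := fun s hs => (hL s hs).lawOK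
  have hQ0 : 0 < fQ L := lt_trans hq0 hhub
  set c : ℝ := sk.q / fQ L with hcdef
  have hc0 : 0 < c := div_pos hq0 hQ0
  have hc1 : c < 1 := by rw [hcdef, div_lt_one hQ0]; exact hhub
  have hbfl0 : 0 < bfl L := bfl_pos L hL hB
  set wU : ℝ := min (bfl L) (c * sk.x₁) with hwUdef
  obtain ⟨gc0, gcM, gc1⟩ := gate_laws sk.M sk.ρ c hc0.le hc1.le ρ0 ρM ρ1
  intro g hg0 hg1 j hj
  -- the law as a mixture of the pieces with the carrier hung under them
  have emix : fbeta L = fun k => ∑ i, ω i * P i k := funext hmix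
  have hconv : ∀ h, lconv (ftop L) sk.M (fbeta L) (gate sk.ρ c) h = ∑ i, ω i * lconv (ftop L) sk.M (P i) (gate sk.ρ c) h := by
    intro h; rw [emix]; exact lconv_fsum_left Finset.univ _ _ ω P _ h
  have hgate : ∀ h, gate (lconv (ftop L) sk.M (fbeta L) (gate sk.ρ c)) g h
      = ∑ i, ω i * gate (lconv (ftop L) sk.M (P i) (gate sk.ρ c)) g h := by
    intro h
    have e : lconv (ftop L) sk.M (fbeta L) (gate sk.ρ c) = fun k => ∑ i, ω i * lconv (ftop L) sk.M (P i) (gate sk.ρ c) k :=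
      funext hconv
    rw [e]
    exact gate_sum_affine Finset.univ ω _ g hω1 h
  -- each piece
  have hpiece : ∀ i, DECAtT (g * wU) (g * (bT L + c * sk.mean)) j (ftop L + sk.M) (gate (lconv (ftop L) sk.M (P i) (gate sk.ρ c)) g) := by
    intro i
    obtain ⟨hTP, hyfl, hmg, hPmean⟩ := hP i
    obtain ⟨hy0, hy1, P0, PM, P1, _⟩ := hTP.lawFacts
    have hfl0 : 0 < min (y i) (c * sk.x₁) := lt_min hy0 (mul_pos hc0 hx₁0)
    have hZ : TreeBuiltN (min (y i) (c * sk.x₁)) (m i + (sk.n + 1)) (ftop L + sk.M) (lconv (ftop L) sk.M (P i) (gate sk.ρ c)) :=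
      TreeBuiltN.conv (TreeBuiltN.mono hTP hfl0 (min_le_left _ _))
        (TreeBuiltN.mono (TreeBuiltN.gate c hc0 hc1 hT) hfl0 (min_le_right _ _))
    have hSZ : SDEC (min (y i) (c * sk.x₁)) (ftop L + sk.M) (lconv (ftop L) sk.M (P i) (gate sk.ρ c)) :=
      hO _ _ _ _ (by simp only [fgates]; omega) hZ
    have d := hSZ g hg0 hg1 j hj
    have hle : g * wU ≤ g * min (y i) (c * sk.x₁) :=
      mul_le_mul_of_nonneg_left (le_min ((min_le_left _ _).trans hyfl) (min_le_right _ _)) hg0.le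
    have hlt1 : g * min (y i) (c * sk.x₁) < 1 := by
      have : min (y i) (c * sk.x₁) ≤ y i := min_le_left _ _
      nlinarith
    have d' := decAt_mono_floor hle hlt1 d
    rw [decAt_iff_decAtT, sum_mul_gate, sum_mul_lconv _ _ _ _ P1 gc1, hPmean, sum_mul_gate] at d'
    exact d'
  have hmixdec := decAtT_mixture_finset Finset.univ ω (fun i => gate (lconv (ftop L) sk.M (P i) (gate sk.ρ c)) g)
    (fun i _ => (hω0 i).le) hω1 (fun i _ _ => hpiece i)
  -- the mean of the whole law
  obtain ⟨β0, βM, β1, βmean⟩ := fbeta_laws L hL' hne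
  have hmean : ∑ h ∈ Finset.range (ftop L + sk.M + 1), (h : ℝ) * gate (lconv (ftop L) sk.M (fbeta L) (gate sk.ρ c)) g h
      = g * (bT L + c * sk.mean) := by
    rw [sum_mul_gate, sum_mul_lconv _ _ _ _ β1 gc1, βmean, sum_mul_gate]; rfl
  rw [decAt_iff_decAtT, hmean]
  exact decAtT_congr (fun h => (hgate h).symm) hmixdec

/-- **IDENTITY I_k (k-GENERAL, BUBBLE REGION): the sibling step for `carrier :: compound`.**  For a floor `0 < x < 1`, a tree-built carrier `sk` and
compound list `L` at floor `x`, GIVEN the oracle below `fgates (sk :: L)` (the induction hypothesis of `SiblingStep`): if the compound is the hub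
(`sk.q < fQ L`), the compound is in the bubble region (`BubbleOK L`) and the bubble floors clear the forest floor (`x ≤ fQ L · bfl L`), then
`flaw (sk :: L)` is SDEC at `x` — the list form of the sibling step on this family, every width.  At `k = 3` this is arm-1 g46's identity I. [this work] -/
theorem sdec_flaw_cons_of_bubble {x : ℝ} (hx0 : 0 < x) (hx1 : x < 1) (sk : Sib) (L : List Sib)
    (hk : sk.TreeOK x) (hL : ∀ s ∈ L, s.TreeOK x) (hB : BubbleOK L)
    (hO : ∀ (x' : ℝ) (n' M' : ℕ) (μ' : ℕ → ℝ), n' < fgates (sk :: L) → TreeBuiltN x' n' M' μ' → SDEC x' M' μ')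
    (hhub : sk.q < fQ L) (hxU : x ≤ fQ L * bfl L) :
    SDEC x (ftop (sk :: L)) (flaw (sk :: L)) := by
  have hne : L ≠ [] := by rintro rfl; exact hB
  have hU := sdec_upart_of_bubble hx0 hx1 sk L hk hL hB hO hhub
  obtain ⟨hq0, hq1, hxq, hT, hnp⟩ := hk
  obtain ⟨hx₁0, hx₁1, _, _, _, _⟩ := hT.lawFacts
  have hQ0 : 0 < fQ L := lt_trans hq0 hhub
  have hbfl0 : 0 < bfl L := bfl_pos L hL hB
  have hc0 : 0 < sk.q / fQ L := div_pos hq0 hQ0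
  have hc1 : sk.q / fQ L < 1 := by rw [div_lt_one hQ0]; exact hhub
  have hw0 : 0 ≤ min (bfl L) (sk.q / fQ L * sk.x₁) := (lt_min hbfl0 (mul_pos hc0 hx₁0)).le
  have hw1 : min (bfl L) (sk.q / fQ L * sk.x₁) < 1 := by
    have : sk.q / fQ L * sk.x₁ < 1 := by nlinarith
    exact lt_of_le_of_lt (min_le_right _ _) this
  refine sdec_flaw_cons_of_upart hx0 hx1 sk L ⟨hq0, hq1, hxq, hT, hnp⟩ hL hne hO hhub.le _ hw0 hw1 hU ?_
  -- `x ≤ fQ L · min (bfl L) (c·x₁)`: both `x ≤ fQ L · bfl L` and `x ≤ q·x₁ = fQ L · c · x₁`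
  rcases le_total (bfl L) (sk.q / fQ L * sk.x₁) with hle | hle
  · rw [min_eq_left hle]; exact hxU
  · rw [min_eq_right hle]
    have : fQ L * (sk.q / fQ L * sk.x₁) = sk.q * sk.x₁ := by field_simp
    rw [this]; exact hxq

end LawDec
end Quant
end Summit.CriticalPhenomena.PercolationContinuityZ3.Theorems
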